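import Summits.BirchSwinnertonDyer.BirchSwinnertonDyer.Theorems.PrintX9MuPartSpecWitnessAlongDefs
import Summits.BirchSwinnertonDyer.BirchSwinnertonDyer.Theorems.PrintX9MuPartStabilizedOfSpecWitnesses
import HarnessLib

/-!
# The shared μ-residual FROM WITNESSES ALONG AN INFINITE SET OF LEVELS: the subsequence μ-transfer and
# `SpecWitnessesCoherentPairAlong → MuPartStabilizedCoherentPair` (proofs file)

Cell `pub/bsd-print-x9`, seat `bsd-line-x9-p1-w3` (g3, extra width on line `torsion-depth-pinned`), for the
μ-LEAD lineage `bsd-line-x9-p1` (crux stmt-BirchSwinnertonDyer-27077; skeleton v8's one stub is the L∃ letter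
`MuPartStabilizedCoherentPair`, p630902). THEOREMS ONLY; no definition, no named fact, no `sorry`;
ROUTE-INDEPENDENT (imports no `Theses` file). Transcribed into the importable tree from bsd-idea-16's crux
workfile `Cruxes/HowardContainmentAnyClassNumberX10b/Lines/specialise_first_mu_x10b.lean` v11 §14 (card
`specialise-first-mu-x10b` v11; proofs by bsd-idea-16 g5, re-homed here with the namespace of the shared
letter); design credit: bsd-idea-16.

WHAT (the level quantifier of the specialised road is ∃-INFINITE, not ∀-COFINITE).
* `le_of_frequently_pow_mul_le`: `1 < p` and `p^(m·u) ≤ D · p^(m·v)` for infinitely many `m` ⟹ `u ≤ v`.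
* `muInvariant_le_two_mul_of_frequently_card_le` / `lengthAt_le_two_mul_of_frequently_card_le`: for f.g.
  torsion `Λ`-modules `N`, `N'`, the specialised inequality `#(N/q_m N) ≤ p^C · #(N'/q_m N')²` along an
  INFINITE set of levels `m` already gives `μ(N) ≤ 2 μ(N')`, resp. `length_(p) N ≤ 2 · length_(p) N'` — the
  two-sided asymptotics `IwasawaAlgebra.exists_card_quotSMulTop_qm_bounds` (x10b-p1, p625052) do the rest
  (the all-large-`m` form is `IwasawaAlgebra.lengthAt_le_two_mul_of_card_quotSMulTop_qm_le`).
* **`lengthAt_torsion_le_two_mul_of_hasSpecWitnessesAlong`** — the pointwise theorem along a subsequence: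
  `S`, `X` f.g., `S/L` torsion, `HasSpecWitnessesAlong p S X L` ⟹ `length_(p)(X_tors) ≤ 2 · length_(p)(S/L)`
  (one `card_quot_torsion_le_of_specWitness`, p633080, at each good level).
* **`muPartStabilizedCoherentPair_of_specWitnessesCoherentPairAlong`** — the weakened shell gives the
  installed L∃ LETTER `MuPartStabilizedCoherentPair` (THE CUT v2 item text) BY NAME; with
  `specWitnessesCoherentPairAlong_of_specWitnessesCoherentPair` (defs file) the targets are kernel-ordered
  `SpecWitnessesCoherentPair ⟹ SpecWitnessesCoherentPairAlong ⟹ MuPartStabilizedCoherentPair`.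
TEETH for the D1 port: the specialisation `T ↦ π_m` (`π_m^m = -p`) twists the Galois action through
`γ ↦ 1 + π_m`; the m-uniform control (S1) and the residual inputs may now use a convenient residue class of
`m` (e.g. `p^t ∣ m`) or discard any finite / density-zero set of bad levels.
HONEST FRAMING: neither shell is proved anywhere (they are the port's deliverable, beyond citable print at
`p ∣ h_K`, REF-118); this file records in the kernel that the weaker one suffices. «beyond-print theorem»: no.
BSD is not proved by any of this; no summit statement is proved by this seat.

References: [Howard2004HeegnerKolyvagin] proof of Thm. 2.2.10 (the height-one prime `pΛ` via `𝔮 = T^m + p`,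
`m → ∞`); [MastellaZerman2026] Thm. 2.40; [Washington1997] §13.2.
-/

set_option linter.dupNamespace false
set_option autoImplicit false

noncomputable section

open scoped Classical

open Literature Literature.NumberTheory.EllipticCurves WeierstrassCurve

namespace Summit.BirchSwinnertonDyer.BirchSwinnertonDyer.Theorems.HeegnerMuPartStabilized

/-! ## Exponent comparison and μ-transfer along an infinite set of levels -/

/-- **Exponent comparison along a subsequence.** If `1 < p` and `p^(m·u) ≤ D · p^(m·v)` for infinitely many
`m`, then `u ≤ v` (at a level `m ≥ D` with `u > v` one would get `p^m ≤ D < p^m`).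
[cite: Howard2004HeegnerKolyvagin, Thm. 2.2.10 (proof: 𝔮 = (T^m + p), m → ∞)] -/
theorem le_of_frequently_pow_mul_le {p : ℕ} (hp : 1 < p) {u v D : ℕ}
    (h : ∀ M : ℕ, ∃ m, M ≤ m ∧ p ^ (m * u) ≤ D * p ^ (m * v)) : u ≤ v := by
  by_contra huv
  push Not at huv
  obtain ⟨m, hDm, hm⟩ := h D
  have hpm : p ^ (m * v) * p ^ m ≤ p ^ (m * u) := by
    rw [← pow_add]
    exact Nat.pow_le_pow_right (by omega) (by nlinarith)
  have hle : p ^ (m * v) * p ^ m ≤ p ^ (m * v) * D := by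
    calc p ^ (m * v) * p ^ m ≤ p ^ (m * u) := hpm
      _ ≤ D * p ^ (m * v) := hm
      _ = p ^ (m * v) * D := by ring
  have hD : p ^ m ≤ D := Nat.le_of_mul_le_mul_left hle (by positivity)
  have hlt : D < p ^ m := lt_of_le_of_lt hDm (Nat.lt_pow_self hp)
  omega

/-- **μ-transfer along a subsequence (μ-invariant currency).** For f.g. torsion `Λ`-modules `N`, `N'`: if
`#(N/q_m N) ≤ p^C · #(N'/q_m N')²` for INFINITELY MANY `m`, then `μ(N) ≤ 2 μ(N')` (two-sided asymptotics
`IwasawaAlgebra.exists_card_quotSMulTop_qm_bounds` of both counts, then `le_of_frequently_pow_mul_le`).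
[cite: Howard2004HeegnerKolyvagin, proof of Thm. 2.2.10] [cite: Washington1997, §13.2] -/
theorem muInvariant_le_two_mul_of_frequently_card_le (p : ℕ) [Fact p.Prime] (N N' : Type*) [AddCommGroup N]
    [Module (IwasawaAlgebra p) N] [AddCommGroup N'] [Module (IwasawaAlgebra p) N']
    [Module.Finite (IwasawaAlgebra p) N] [Module.Finite (IwasawaAlgebra p) N']
    (hN : Module.IsTorsion (IwasawaAlgebra p) N) (hN' : Module.IsTorsion (IwasawaAlgebra p) N')
    (h : ∃ C : ℕ, ∀ M : ℕ, ∃ m : ℕ, M ≤ m ∧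
      Nat.card (N ⧸ (Ideal.span {(PowerSeries.X ^ m + PowerSeries.C (p : ℤ_[p]) : IwasawaAlgebra p)} • ⊤ :
        Submodule (IwasawaAlgebra p) N)) ≤
      p ^ C * Nat.card (N' ⧸ (Ideal.span {(PowerSeries.X ^ m + PowerSeries.C (p : ℤ_[p]) :
        IwasawaAlgebra p)} • ⊤ : Submodule (IwasawaAlgebra p) N')) ^ 2) :
    muInvariant p N ≤ 2 * muInvariant p N' := by
  have hp : p.Prime := Fact.out
  obtain ⟨C, hC⟩ := h
  obtain ⟨B, m₁, -, h1⟩ := IwasawaAlgebra.exists_card_quotSMulTop_qm_bounds p N hN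
  obtain ⟨B', m₂, -, h2⟩ := IwasawaAlgebra.exists_card_quotSMulTop_qm_bounds p N' hN'
  refine le_of_frequently_pow_mul_le hp.one_lt (D := B * p ^ C * B' ^ 2) fun M => ?_
  obtain ⟨m, hm, hcm⟩ := hC (max M (max m₁ m₂))
  have hM : M ≤ m := le_trans (le_max_left _ _) hm
  have hm1 : m₁ ≤ m := le_trans (le_trans (le_max_left _ _) (le_max_right _ _)) hm
  have hm2 : m₂ ≤ m := le_trans (le_trans (le_max_right _ _) (le_max_right _ _)) hm
  obtain ⟨-, hlow, -⟩ := h1 m hm1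
  obtain ⟨-, -, hup⟩ := h2 m hm2
  refine ⟨m, hM, ?_⟩
  calc p ^ (m * muInvariant p N) ≤ B * Nat.card (N ⧸ _) := hlow
    _ ≤ B * (p ^ C * Nat.card (N' ⧸ _) ^ 2) := Nat.mul_le_mul_left _ hcm
    _ ≤ B * (p ^ C * (B' * p ^ (m * muInvariant p N')) ^ 2) := by gcongr
    _ = B * p ^ C * B' ^ 2 * p ^ (m * (2 * muInvariant p N')) := by ring

/-- **μ-transfer along a subsequence, local-length currency** (the hypothesis shape of the promotion lemmas):
`length_{Λ_(p)} N_(p) ≤ 2 · length_{Λ_(p)} N'_(p)` for f.g. torsion `N`, `N'` satisfying the specialised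
inequality at infinitely many `q_m`. [cite: Howard2004HeegnerKolyvagin, proof of Thm. 2.2.10]
[cite: Washington1997, §13.2] -/
theorem lengthAt_le_two_mul_of_frequently_card_le (p : ℕ) [Fact p.Prime] (N N' : Type*) [AddCommGroup N]
    [Module (IwasawaAlgebra p) N] [AddCommGroup N'] [Module (IwasawaAlgebra p) N']
    [Module.Finite (IwasawaAlgebra p) N] [Module.Finite (IwasawaAlgebra p) N']
    (hN : Module.IsTorsion (IwasawaAlgebra p) N) (hN' : Module.IsTorsion (IwasawaAlgebra p) N')
    (h : ∃ C : ℕ, ∀ M : ℕ, ∃ m : ℕ, M ≤ m ∧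
      Nat.card (N ⧸ (Ideal.span {(PowerSeries.X ^ m + PowerSeries.C (p : ℤ_[p]) : IwasawaAlgebra p)} • ⊤ :
        Submodule (IwasawaAlgebra p) N)) ≤
      p ^ C * Nat.card (N' ⧸ (Ideal.span {(PowerSeries.X ^ m + PowerSeries.C (p : ℤ_[p]) :
        IwasawaAlgebra p)} • ⊤ : Submodule (IwasawaAlgebra p) N')) ^ 2)
    (𝔭 : PrimeSpectrum (IwasawaAlgebra p)) (h𝔭 : 𝔭.asIdeal = Ideal.span {(p : IwasawaAlgebra p)}) :
    Module.lengthAt (IwasawaAlgebra p) N 𝔭 ≤ 2 * Module.lengthAt (IwasawaAlgebra p) N' 𝔭 := by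
  have h1 := muInvariant_le_two_mul_of_frequently_card_le p N N' hN hN' h
  have h𝔭' : 𝔭.asIdeal = IwasawaAlgebra.augIdealP p := by
    rw [h𝔭, IwasawaAlgebra.span_natCast_eq_augIdealP]
  have hN1 := lengthAt_ne_top_of_isTorsion p N hN 𝔭 h𝔭'
  have hN2 := lengthAt_ne_top_of_isTorsion p N' hN' 𝔭 h𝔭'
  rw [muInvariant_eq_toNat_lengthAt p N 𝔭 h𝔭', muInvariant_eq_toNat_lengthAt p N' 𝔭 h𝔭'] at h1
  rw [← ENat.coe_toNat hN1, ← ENat.coe_toNat hN2]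
  exact_mod_cast h1

/-! ## The pointwise theorem along an infinite set of levels, and the L∃ letter BY NAME -/

/-- **THE POINTWISE THEOREM ALONG A SUBSEQUENCE: `HasSpecWitnessesAlong` ⟹ the μ-inequality at `(p)`.** For
`Λ`-modules `S ⊇ L` and `X` with `S`, `X` finitely generated and `S/L` torsion: witnesses at infinitely many
`q_m` with an `m`-uniform constant give `length_{Λ_(p)}((X_tors)_(p)) ≤ 2 · length_{Λ_(p)}((S/L)_(p))`
(`card_quot_torsion_le_of_specWitness` at each good level + `lengthAt_le_two_mul_of_frequently_card_le`).
[cite: Howard2004HeegnerKolyvagin, proof of Thm. 2.2.10 (𝔮 = T^m + p)] [cite: Washington1997, §13.2] -/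
theorem lengthAt_torsion_le_two_mul_of_hasSpecWitnessesAlong (p : ℕ) [Fact p.Prime] {S X : Type}
    [AddCommGroup S] [Module (IwasawaAlgebra p) S] [AddCommGroup X] [Module (IwasawaAlgebra p) X]
    [Module.Finite (IwasawaAlgebra p) S] [Module.Finite (IwasawaAlgebra p) X]
    (L : Submodule (IwasawaAlgebra p) S) (hL : Module.IsTorsion (IwasawaAlgebra p) (S ⧸ L))
    (hW : HasSpecWitnessesAlong p S X L)
    (𝔭 : PrimeSpectrum (IwasawaAlgebra p)) (h𝔭 : 𝔭.asIdeal = Ideal.span {(p : IwasawaAlgebra p)}) :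
    Module.lengthAt (IwasawaAlgebra p) (Submodule.torsion (IwasawaAlgebra p) X) 𝔭 ≤
      2 * Module.lengthAt (IwasawaAlgebra p) (S ⧸ L) 𝔭 := by
  haveI : IsNoetherian (IwasawaAlgebra p) X := isNoetherian_of_isNoetherianRing_of_finite _ _
  haveI : Module.Finite (IwasawaAlgebra p) (Submodule.torsion (IwasawaAlgebra p) X) := inferInstance
  haveI : Module.Finite (IwasawaAlgebra p) (S ⧸ L) := inferInstance
  have htor := Submodule.torsion_isTorsion (R := IwasawaAlgebra p) (M := X)
  refine lengthAt_le_two_mul_of_frequently_card_le p _ _ htor hL ?_ 𝔭 h𝔭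
  obtain ⟨c, hw⟩ := hW
  obtain ⟨B, m₁, -, h1⟩ := IwasawaAlgebra.exists_card_quotSMulTop_qm_bounds p _ htor
  obtain ⟨B', m₂, -, h2⟩ := IwasawaAlgebra.exists_card_quotSMulTop_qm_bounds p _ hL
  refine ⟨3 * c, fun M => ?_⟩
  obtain ⟨m, hm, ⟨w⟩⟩ := hw (max M (max m₁ m₂))
  haveI := (h1 m (le_trans (le_trans (le_max_left _ _) (le_max_right _ _)) hm)).1
  haveI := (h2 m (le_trans (le_trans (le_max_right _ _) (le_max_right _ _)) hm)).1
  refine ⟨m, le_trans (le_max_left _ _) hm, ?_⟩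
  calc _ ≤ _ := card_quot_torsion_le_of_specWitness (IwasawaAlgebra.X_pow_add_C_ne_zero p m) w
    _ = _ := by rw [← pow_mul, mul_comm c 3]

/-- **Weakened shell ⟹ the installed L∃ LETTER `MuPartStabilizedCoherentPair` (p630902) BY NAME.** The D1
constructor exports its own `(C, F)` and witnesses AT THAT `C` at infinitely many levels of ITS choosing; no
`∀ C` transfer debt, no all-large-`m` debt. [cite: Howard2004HeegnerKolyvagin, proof of Thm. 2.2.10 (𝔮 = T^m + p)]
[cite: MastellaZerman2026, Thm. 2.40] -/
theorem muPartStabilizedCoherentPair_of_specWitnessesCoherentPairAlong (hW : SpecWitnessesCoherentPairAlong) :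
    MuPartStabilizedCoherentPair := by
  intro N _ W _ K _ _ p _ κ γ jbar hyp hcm hirr hirrK hsc hHp hhK hpN hTw1 hcardp Dt β hβ D X
  obtain ⟨C, F, hCDt, hFDt, hCβ, hFβ, hfwd, hrev, hWit⟩ :=
    hW N W K p κ γ jbar hyp hcm hirr hirrK hsc hHp hhK hpN hTw1 hcardp Dt β hβ D X
  refine ⟨C, F, hCDt, hFDt, hCβ, hFβ, hfwd, hrev, fun hfinS hfinX htorC 𝔭 h𝔭 => ?_⟩
  haveI := hfinS
  haveI := hfinX
  exact lengthAt_torsion_le_two_mul_of_hasSpecWitnessesAlong p _ htorC (hWit hfinS hfinX htorC) 𝔭 h𝔭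

end Summit.BirchSwinnertonDyer.BirchSwinnertonDyer.Theorems.HeegnerMuPartStabilized

end
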